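import Mathlib
import Summits.QuantumFields.YangMills.Theorems.SpecificationCompactnessGibbsLimitUniquenessDoeblin
import HarnessLib

/-!
# Route `SpecificationCompactness` — crux C1 `PointwiseSpecificationLimit` (stmt-QuantumFields-28303): THE ONE-LINK FIBRE KERNEL,
# generic part — «one-link ratio limits + ceiling ⇒ the single-link conditional densities converge a.e. to a fibre-normalised limit»
# on any finite product `(ι → G, ⊗_ι η)` (the measure theory of the registered stub `stub_fibreLimit` of the line
# «link_ratio_limit», planner ym-idea-5 g9 LINE 13 v2; the route-vocabulary instance is the sibling module
# `SpecificationCompactnessFibreRatioLimit`)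

Cell `ym-idea-1` width seat `ym-line-sfw-p2-w3` gen 27 (free hands), for the neighbouring cell `ym-idea-5`'s deciding crux C1.

THE ARGUMENT (Kallenberg's disintegration in the independent case + dominated convergence on one fibre).
* §1 `apply_update_eq_of_measurable_comap`: a function measurable for the σ-algebra of the links `≠ e` does not see the link `e`
  (`f(W[e↦a]) = f(W)`, Doob–Dynkin through `measurableSet_comap`); `ae_ae_update_notMem`: a `⊗η`-null set is `η`-null on
  `⊗η`-almost every `e`-fibre (the tree's `condExp_pi_ae_eq_integral_update` applied to the indicator of a measurable null hull).
* §2 `tendsto_condDensity_of_ratio` (one configuration): if `u_K ≥ 0`, the ratios `u_K(W[e↦a])/u_K(W)` are `≤ B` from `K₀` on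
  and converge to `R(a) > 0` for every `a`, and `c_K = ∫ u_K(W[e↦a]) dη(a)`, then `u_K(W) > 0` eventually (ratio at `a = W e`),
  `∫ ratio_K dη → ∫ R dη > 0` (dominated convergence), `u_K(W)/c_K = (∫ ratio_K dη)⁻¹ → (∫ R dη)⁻¹`, and a ceiling
  `δ u_K(W) ≤ c_K` gives `(∫ R dη)⁻¹ ≤ δ⁻¹`.
* §3 `condDensity_limit_ae` (almost every configuration, links-`≠ e` σ-algebra): the conditional densities
  `p_K = u_K/E[u_K | ≠e]` converge a.e. to `q := (∫ R(·,a) dη)⁻¹ ≤ δ⁻¹` and the limit is FIBRE-NORMALISED, `E[q | ≠e] = 1` a.e. —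
  transport the a.e. statements to a.e. fibre (§1), dominated convergence with the bound `δ⁻¹` along the fibre, and
  `∫ p_K(W[e↦a]) dη(a) = 1` exactly since `E[u_K | ≠e]` does not see the link `e`; `continuous_invIntegral`: for continuous
  positive `R` on a compact product, `q` is continuous with the uniform floor `(max (sup R) 1)⁻¹`.

HONEST FRAMING: pure measure theory; rung R3 RECORD line (leaf `YM3TorusSU2`, not Clay); nothing here touches the Bałaban content of
C1 or C2; no crux, route, rung or mass gap is proved.  Sources: O. Kallenberg, *Foundations of Modern Probability* (2002), Thm 6.4 /
Lemma 1.13 / Lemma 3.11; S. Friedli, Y. Velenik, *Statistical Mechanics of Lattice Systems* (2017), Lemma 6.27.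
-/

noncomputable section

namespace Summit.QuantumFields.YangMills.Theorems.SpecificationCompactnessFibreRatioKernel

open MeasureTheory Filter Topology Function Set
open Summit.QuantumFields.YangMills.Theorems.GibbsLimitUniqueness (condExp_pi_ae_eq_integral_update)

/-! ## §1 The `links ≠ e` σ-algebra: invariance under resampling the link `e`; null sets restricted to fibres -/

section Product

variable {ι : Type*} [Fintype ι] [DecidableEq ι] {G : Type*} [MeasurableSpace G] (η : Measure G) [IsProbabilityMeasure η] (e : ι)

omit [Fintype ι] in
/-- **A function measurable for the σ-algebra generated by the links `≠ e` does not depend on the link `e`**: `f(W[e ↦ a]) = f(W)`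
(Doob–Dynkin: the level set `f⁻¹{f W}` is the preimage of a measurable set of restricted configurations, and `W[e ↦ a]` has the
same restriction as `W`). [cite: Kallenberg2002, Lemma 1.13] -/
theorem apply_update_eq_of_measurable_comap {f : (ι → G) → ℝ}
    (hf : Measurable[MeasurableSpace.comap (fun (W : ι → G) (b : {b // b ≠ e}) => W b.1) MeasurableSpace.pi] f)
    (W : ι → G) (a : G) : f (update W e a) = f W := by
  have hs : MeasurableSet[MeasurableSpace.comap (fun (W : ι → G) (b : {b // b ≠ e}) => W b.1) MeasurableSpace.pi]
      (f ⁻¹' {f W}) := hf (measurableSet_singleton _)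
  obtain ⟨s', -, hs'⟩ := MeasurableSpace.measurableSet_comap.mp hs
  have hW : W ∈ (fun (W : ι → G) (b : {b // b ≠ e}) => W b.1) ⁻¹' s' := by
    rw [hs']; exact rfl
  have h2 : (fun b : {b // b ≠ e} => (update W e a) b.1) = fun b : {b // b ≠ e} => W b.1 := by
    funext b; exact update_of_ne b.2 a W
  have h3 : update W e a ∈ (fun (W : ι → G) (b : {b // b ≠ e}) => W b.1) ⁻¹' s' := by
    show (fun b : {b // b ≠ e} => (update W e a) b.1) ∈ s'
    rw [h2]; exact hW
  rw [hs'] at h3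
  exact h3

/-- **A `⊗η`-NULL SET IS `η`-NULL ON ALMOST EVERY `e`-FIBRE**: if `(⊗_ι η) N = 0` then for `⊗η`-a.e. `W`, `W[e ↦ a] ∉ N` for
`η`-a.e. `a` (the disintegration `condExp_pi_ae_eq_integral_update` of the tree applied to the indicator of a measurable null hull
of `N`). [cite: Kallenberg2002, Thm 6.4] -/
theorem ae_ae_update_notMem {N : Set (ι → G)} (hN : (Measure.pi fun _ : ι => η) N = 0) :
    ∀ᵐ W ∂(Measure.pi fun _ : ι => η), ∀ᵐ a ∂η, update W e a ∉ N := by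
  set N' : Set (ι → G) := toMeasurable (Measure.pi fun _ : ι => η) N with hN'def
  have hN'm : MeasurableSet N' := measurableSet_toMeasurable _ _
  have hN'0 : (Measure.pi fun _ : ι => η) N' = 0 := by rw [hN'def, measure_toMeasurable]; exact hN
  have hsub : N ⊆ N' := subset_toMeasurable _ _
  set g : (ι → G) → ℝ := N'.indicator 1 with hgdef
  have hgm : StronglyMeasurable g := (measurable_one.indicator hN'm).stronglyMeasurable
  have hgi : Integrable g (Measure.pi fun _ : ι => η) := (integrable_const (1 : ℝ)).indicator hN'm
  have hfib := condExp_pi_ae_eq_integral_update η e hgm hgi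
  have hg0 : g =ᵐ[Measure.pi fun _ : ι => η] (0 : (ι → G) → ℝ) := by
    filter_upwards [measure_eq_zero_iff_ae_notMem.mp hN'0] with W hW
    simp [hgdef, Set.indicator_of_notMem hW]
  have hc0 : (Measure.pi fun _ : ι => η)[g | MeasurableSpace.comap (fun (W : ι → G) (b : {b // b ≠ e}) => W b.1)
      MeasurableSpace.pi] =ᵐ[Measure.pi fun _ : ι => η] (0 : (ι → G) → ℝ) := by
    have h := condExp_congr_ae (m := MeasurableSpace.comap (fun (W : ι → G) (b : {b // b ≠ e}) => W b.1) MeasurableSpace.pi) hg0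
    rw [condExp_zero] at h
    exact h
  filter_upwards [hfib, hc0] with W h1 h2
  have h3 : ∫ a, g (update W e a) ∂η = 0 := by rw [← h1]; exact h2
  have h4 : (fun a => g (update W e a)) = (update W e ⁻¹' N').indicator 1 := by
    funext a
    by_cases ha : update W e a ∈ N'
    · simp [hgdef, Set.indicator_of_mem ha, Set.indicator_of_mem (show a ∈ update W e ⁻¹' N' from ha)]
    · simp [hgdef, Set.indicator_of_notMem ha, Set.indicator_of_notMem (show a ∉ update W e ⁻¹' N' from ha)]
  rw [h4, integral_indicator_one (measurable_update W hN'm)] at h3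
  have h5 : η (update W e ⁻¹' N') = 0 := (measureReal_eq_zero_iff (measure_ne_top _ _)).mp h3
  filter_upwards [measure_eq_zero_iff_ae_notMem.mp h5] with a ha
  exact fun h => ha (hsub h)

/-! ## §2 One configuration: ratios + fibre formula (+ ceiling) ⇒ the conditional density converges to `(∫ R dw)⁻¹` -/

omit [Fintype ι] in
/-- **ONE-LINK CONDITIONAL DENSITIES FROM ONE-LINK RATIOS, AT ONE CONFIGURATION.**  Let `u_K ≥ 0` on `ι → G`, `W` a configuration
with: the ratios `u_K(W[e↦a])/u_K(W)` are `≤ B` for `K ≥ K₀` and converge to `R(W,a) > 0` for every `a` (`R(W,·)` measurable), and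
`c_K = ∫ u_K(W[e↦a]) dη(a)` for all `K` (the values of `E[u_K | links ≠ e]` at `W`).  Then `u_K(W) > 0` eventually,
`0 < ∫ R(W,a) dη ≤ B`... and the conditional density `u_K(W)/c_K` converges to `(∫ R(W,a) dη(a))⁻¹`; if moreover
`δ·u_K(W) ≤ c_K` for `K ≥ K₁` (`δ > 0`) then `(∫ R(W,a) dη)⁻¹ ≤ δ⁻¹`. [cite: Kallenberg2002, Thm 6.4] -/
theorem tendsto_condDensity_of_ratio (u : ℕ → (ι → G) → ℝ) (hum : ∀ K, Measurable (u K)) (hu0 : ∀ K W, 0 ≤ u K W)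
    (W : ι → G) (R : G → ℝ) (hRm : Measurable R) (hR0 : ∀ a, 0 < R a)
    {B : ℝ} {K₀ : ℕ} (hB : ∀ K, K₀ ≤ K → ∀ a, u K (update W e a) ≤ B * u K W)
    (hlim : ∀ a, Tendsto (fun K => u K (update W e a) / u K W) atTop (𝓝 (R a)))
    (c : ℕ → ℝ) (hc : ∀ K, c K = ∫ a, u K (update W e a) ∂η) :
    (∀ᶠ K in atTop, 0 < u K W) ∧ 0 < ∫ a, R a ∂η ∧ (∀ᶠ K in atTop, 0 < c K) ∧
      Tendsto (fun K => u K W / c K) atTop (𝓝 (∫ a, R a ∂η)⁻¹) ∧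
      ∀ {δ : ℝ}, 0 < δ → ∀ {K₁ : ℕ}, (∀ K, K₁ ≤ K → δ * u K W ≤ c K) → (∫ a, R a ∂η)⁻¹ ≤ δ⁻¹ := by
  -- (a) positivity of `u K W` eventually: the ratio at `a = W e` is `u_K(W)/u_K(W) → R(W e) > 0`
  have hself : Tendsto (fun K => u K W / u K W) atTop (𝓝 (R (W e))) := by
    simpa only [update_eq_self] using hlim (W e)
  have hpos : ∀ᶠ K in atTop, 0 < u K W := by
    have h1 : ∀ᶠ K in atTop, R (W e) / 2 < u K W / u K W :=
      hself.eventually (lt_mem_nhds (by linarith [hR0 (W e)]))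
    filter_upwards [h1] with K hK
    rcases (hu0 K W).lt_or_eq with h | h
    · exact h
    · exfalso
      rw [← h, div_zero] at hK
      linarith [hR0 (W e)]
  obtain ⟨K₂, hK₂⟩ := eventually_atTop.mp hpos
  -- (b) dominated convergence of the ratio integrals along the shifted sequence
  set N₀ : ℕ := max K₀ K₂ with hN₀
  have hposN : ∀ n, 0 < u (n + N₀) W := fun n => hK₂ _ ((le_max_right _ _).trans (Nat.le_add_left _ _))
  have hK₀N : ∀ n, K₀ ≤ n + N₀ := fun n => (le_max_left _ _).trans (Nat.le_add_left _ _)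
  have hratio_le : ∀ n a, u (n + N₀) (update W e a) / u (n + N₀) W ≤ B := fun n a =>
    (div_le_iff₀ (hposN n)).mpr (hB _ (hK₀N n) a)
  have hratio_nn : ∀ n a, 0 ≤ u (n + N₀) (update W e a) / u (n + N₀) W := fun n a =>
    div_nonneg (hu0 _ _) (hposN n).le
  have hdc : Tendsto (fun n => ∫ a, u (n + N₀) (update W e a) / u (n + N₀) W ∂η) atTop (𝓝 (∫ a, R a ∂η)) := by
    refine tendsto_integral_of_dominated_convergence (fun _ => B) ?_ (integrable_const B) ?_ ?_
    · intro n
      exact (((hum _).comp (measurable_update W)).div_const _).aestronglyMeasurable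
    · intro n
      refine Eventually.of_forall fun a => ?_
      rw [Real.norm_eq_abs, abs_of_nonneg (hratio_nn n a)]
      exact hratio_le n a
    · exact Eventually.of_forall fun a => (hlim a).comp (tendsto_add_atTop_nat N₀)
  -- (c) `0 < R ≤ B`, so the limit integral is positive
  have hRle : ∀ a, R a ≤ B := fun a =>
    le_of_tendsto ((hlim a).comp (tendsto_add_atTop_nat N₀)) (Eventually.of_forall fun n => hratio_le n a)
  have hRint : Integrable R η :=
    Integrable.of_bound hRm.aestronglyMeasurable B (Eventually.of_forall fun a => by
      rw [Real.norm_eq_abs, abs_of_pos (hR0 a)]; exact hRle a)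
  have hIpos : 0 < ∫ a, R a ∂η := by
    rw [integral_pos_iff_support_of_nonneg (fun a => (hR0 a).le) hRint]
    have hsupp : support R = univ := eq_univ_of_forall fun a => (hR0 a).ne'
    rw [hsupp, measure_univ]
    exact zero_lt_one
  -- (d) the conditional density is the inverse of the ratio integral
  have hpeq : ∀ n, u (n + N₀) W / c (n + N₀) = (∫ a, u (n + N₀) (update W e a) / u (n + N₀) W ∂η)⁻¹ := by
    intro n
    rw [hc (n + N₀), integral_div, inv_div]
  have hcpos : ∀ᶠ K in atTop, 0 < c K := by
    have h1 : ∀ᶠ n in atTop, 0 < ∫ a, u (n + N₀) (update W e a) / u (n + N₀) W ∂η :=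
      hdc.eventually (lt_mem_nhds hIpos)
    obtain ⟨n₁, hn₁⟩ := eventually_atTop.mp h1
    refine eventually_atTop.mpr ⟨n₁ + N₀, fun K hK => ?_⟩
    obtain ⟨n, rfl⟩ : ∃ n, K = n + N₀ := ⟨K - N₀, by omega⟩
    have h2 := hn₁ n (by omega)
    rw [integral_div] at h2
    have h3 := hposN n
    rw [hc]
    by_contra h4
    push Not at h4
    have : (∫ a, u (n + N₀) (update W e a) ∂η) / u (n + N₀) W ≤ 0 := div_nonpos_of_nonpos_of_nonneg h4 h3.le
    linarith
  have hT : Tendsto (fun K => u K W / c K) atTop (𝓝 (∫ a, R a ∂η)⁻¹) := by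
    rw [← tendsto_add_atTop_iff_nat N₀]
    have h : (fun n => u (n + N₀) W / c (n + N₀)) =
        fun n => (∫ a, u (n + N₀) (update W e a) / u (n + N₀) W ∂η)⁻¹ := funext hpeq
    rw [h]
    exact hdc.inv₀ hIpos.ne'
  refine ⟨hpos, hIpos, hcpos, hT, fun {δ} hδ {K₁} hceil => ?_⟩
  -- (e) the ceiling bound passes to the limit
  refine le_of_tendsto hT (eventually_atTop.mpr ⟨max K₁ K₂, fun K hK => ?_⟩)
  have hp : 0 < u K W := hK₂ K ((le_max_right _ _).trans hK)
  have hcK : δ * u K W ≤ c K := hceil K ((le_max_left _ _).trans hK)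
  have hcpos' : 0 < c K := lt_of_lt_of_le (mul_pos hδ hp) hcK
  rw [div_le_iff₀ hcpos']
  calc u K W = δ⁻¹ * (δ * u K W) := by rw [← mul_assoc, inv_mul_cancel₀ hδ.ne', one_mul]
    _ ≤ δ⁻¹ * c K := mul_le_mul_of_nonneg_left hcK (inv_nonneg.mpr hδ.le)


/-! ## §3 Almost every configuration: convergence of the conditional densities, fibre normalisation of the limit, continuity -/

/-- **RATIOS + CEILING ⇒ THE SINGLE-LINK CONDITIONAL DENSITIES CONVERGE A.E. TO A FIBRE-NORMALISED LIMIT.**  On the product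
`(ι → G, ⊗_ι η)` with the links-`≠ e` σ-algebra `m` (conditional expectations = `e`-fibre integrals,
`condExp_pi_ae_eq_integral_update`; `m`-measurable functions do not see the link `e`, §1): if the non-negative integrable densities
`u_K` have one-link ratio limits `R > 0` with fibre domination (a.e.) and a ceiling `δ·u_K ≤ E[u_K | m]` (a.e., `K ≥ K₁`), then
for a.e. `W` the conditional densities `p_K = u_K/E[u_K | m]` converge to `q := (∫ R(·,a) dη)⁻¹ ≤ δ⁻¹`, and `E[q | m] = 1` a.e.
[cite: Kallenberg2002, Thm 6.4] -/
theorem condDensity_limit_ae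
    (u : ℕ → (ι → G) → ℝ) (hum : ∀ K, Measurable (u K)) (hu0 : ∀ K W, 0 ≤ u K W)
    (hui : ∀ K, Integrable (u K) (Measure.pi fun _ : ι => η))
    (R : (ι → G) × G → ℝ) (hRm : Measurable R) (hR0 : ∀ z, 0 < R z)
    (hrat : ∀ᵐ W ∂(Measure.pi fun _ : ι => η),
      (∃ (B : ℝ) (K₀ : ℕ), ∀ K, K₀ ≤ K → ∀ a, u K (update W e a) ≤ B * u K W) ∧
        ∀ a, Tendsto (fun K => u K (update W e a) / u K W) atTop (𝓝 (R (W, a))))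
    {δ : ℝ} (hδ : 0 < δ) {K₁ : ℕ}
    (hceil : ∀ K, K₁ ≤ K → ∀ᵐ W ∂(Measure.pi fun _ : ι => η),
      δ * u K W ≤ ((Measure.pi fun _ : ι => η)[u K | MeasurableSpace.comap (fun (W : ι → G) (b : {b // b ≠ e}) => W b.1) MeasurableSpace.pi]) W) :
    (∀ᵐ W ∂(Measure.pi fun _ : ι => η),
        Tendsto (fun K => u K W / ((Measure.pi fun _ : ι => η)[u K | MeasurableSpace.comap (fun (W : ι → G) (b : {b // b ≠ e}) => W b.1) MeasurableSpace.pi]) W) atTop (𝓝 (∫ a, R (W, a) ∂η)⁻¹) ∧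
          (∫ a, R (W, a) ∂η)⁻¹ ≤ δ⁻¹) ∧
      ∀ᵐ W ∂(Measure.pi fun _ : ι => η),
        ((Measure.pi fun _ : ι => η)[fun W => (∫ a, R (W, a) ∂η)⁻¹ | MeasurableSpace.comap (fun (W : ι → G) (b : {b // b ≠ e}) => W b.1) MeasurableSpace.pi]) W = 1 := by
  have hm : MeasurableSpace.comap (fun (W : ι → G) (b : {b // b ≠ e}) => W b.1) MeasurableSpace.pi ≤ (MeasurableSpace.pi : MeasurableSpace (ι → G)) :=
    Measurable.comap_le (measurable_pi_lambda _ fun b => measurable_pi_apply (X := fun _ : ι => G) b.1)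
  -- the conditional expectations of the densities (one name for the whole family)
  set c : ℕ → (ι → G) → ℝ := fun K => (Measure.pi fun _ : ι => η)[u K | MeasurableSpace.comap (fun (W : ι → G) (b : {b // b ≠ e}) => W b.1) MeasurableSpace.pi] with hcdef
  have hcm : ∀ K, Measurable[MeasurableSpace.comap (fun (W : ι → G) (b : {b // b ≠ e}) => W b.1) MeasurableSpace.pi] (c K) := fun K => stronglyMeasurable_condExp.measurable
  have hcm0 : ∀ K, Measurable (c K) := fun K => (stronglyMeasurable_condExp.mono hm).measurable
  -- the fibre formula for every `u K`, and the ceiling for every `K ≥ K₁`, almost everywhere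
  have hfibu : ∀ᵐ W ∂(Measure.pi fun _ : ι => η), ∀ K, c K W = ∫ a, u K (update W e a) ∂η := by
    rw [ae_all_iff]
    intro K
    exact condExp_pi_ae_eq_integral_update η e (hum K).stronglyMeasurable (hui K)
  have hceil' : ∀ᵐ W ∂(Measure.pi fun _ : ι => η), ∀ K, K₁ ≤ K → δ * u K W ≤ c K W := by
    rw [ae_all_iff]
    intro K
    by_cases hK : K₁ ≤ K
    · filter_upwards [hceil K hK] with W hW using fun _ => hW
    · exact Eventually.of_forall fun W h => absurd h hK
  -- (1) pointwise consequences at almost every configuration (§2)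
  have part1 : ∀ᵐ W ∂(Measure.pi fun _ : ι => η),
      Tendsto (fun K => u K W / c K W) atTop (𝓝 (∫ a, R (W, a) ∂η)⁻¹) ∧
        (∫ a, R (W, a) ∂η)⁻¹ ≤ δ⁻¹ ∧ 0 < ∫ a, R (W, a) ∂η ∧
        (∀ K, K₁ ≤ K → u K W / c K W ≤ δ⁻¹) ∧
        (∀ᶠ K in atTop, 0 < c K W) ∧
        (∀ K, c K W = ∫ a, u K (update W e a) ∂η) := by
    filter_upwards [hrat, hfibu, hceil'] with W hW hf hc
    obtain ⟨⟨B, K₀, hB⟩, hlim⟩ := hW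
    obtain ⟨-, hIpos, hcpos, hT, hbd⟩ := tendsto_condDensity_of_ratio η e u hum hu0 W (fun a => R (W, a))
      (hRm.comp measurable_prodMk_left) (fun a => hR0 _) hB hlim (fun K => c K W) hf
    refine ⟨hT, hbd hδ hc, hIpos, fun K hK => ?_, hcpos, hf⟩
    rcases (hu0 K W).lt_or_eq with hp | hp
    · have hcK := hc K hK
      have hcpos' : 0 < c K W := lt_of_lt_of_le (mul_pos hδ hp) hcK
      rw [div_le_iff₀ hcpos']
      calc u K W = δ⁻¹ * (δ * u K W) := by rw [← mul_assoc, inv_mul_cancel₀ hδ.ne', one_mul]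
        _ ≤ δ⁻¹ * c K W := mul_le_mul_of_nonneg_left hcK (inv_nonneg.mpr hδ.le)
    · rw [← hp, zero_div]
      exact inv_nonneg.mpr hδ.le
  refine ⟨part1.mono fun W hW => ⟨hW.1, hW.2.1⟩, ?_⟩
  -- (2) the limit `q` is measurable, bounded by `δ⁻¹` a.e., hence integrable
  set q : (ι → G) → ℝ := fun W => (∫ a, R (W, a) ∂η)⁻¹ with hqdef
  have hqm : StronglyMeasurable q := by
    have h1 : StronglyMeasurable fun W : ι → G => ∫ a, R (W, a) ∂η :=
      hRm.stronglyMeasurable.integral_prod_right'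
    exact h1.measurable.inv.stronglyMeasurable
  have hq_bdd : ∀ᵐ W ∂(Measure.pi fun _ : ι => η), ‖q W‖ ≤ δ⁻¹ := by
    filter_upwards [part1] with W hW
    rw [Real.norm_eq_abs, abs_of_pos (inv_pos.mpr hW.2.2.1)]
    exact hW.2.1
  have hqi : Integrable q (Measure.pi fun _ : ι => η) := Integrable.of_bound hqm.aestronglyMeasurable _ hq_bdd
  have hfibq := condExp_pi_ae_eq_integral_update η e hqm hqi
  -- (3) transport (1) to almost every fibre
  have hN : (Measure.pi fun _ : ι => η) {W | ¬ (Tendsto (fun K => u K W / c K W) atTop (𝓝 (q W)) ∧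
      (∀ K, K₁ ≤ K → u K W / c K W ≤ δ⁻¹) ∧
      (∀ K, c K W = ∫ a, u K (update W e a) ∂η))} = 0 := by
    rw [← ae_iff]
    filter_upwards [part1] with W hW using ⟨hW.1, hW.2.2.2.1, hW.2.2.2.2.2⟩
  have hfibre := ae_ae_update_notMem η e hN
  filter_upwards [hfibq, hfibre, part1] with W h1 h2 h3
  rw [h1]
  have h2' : ∀ᵐ a ∂η, Tendsto (fun K => u K (update W e a) / c K (update W e a)) atTop
      (𝓝 (q (update W e a))) ∧
      (∀ K, K₁ ≤ K → u K (update W e a) / c K (update W e a) ≤ δ⁻¹) ∧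
      (∀ K, c K (update W e a) = ∫ a', u K (update (update W e a) e a') ∂η) := by
    filter_upwards [h2] with a ha
    simpa only [mem_setOf_eq, not_not] using ha
  -- (4) dominated convergence along the fibre (shifted by `K₁`, bound `δ⁻¹`)
  have hmeasK : ∀ K, Measurable fun a => u K (update W e a) / c K (update W e a) := fun K =>
    ((hum K).comp (measurable_update W)).div ((hcm0 K).comp (measurable_update W))
  have hdc : Tendsto (fun n => ∫ a, u (n + K₁) (update W e a) / c (n + K₁) (update W e a) ∂η) atTop
      (𝓝 (∫ a, q (update W e a) ∂η)) := by
    refine tendsto_integral_of_dominated_convergence (fun _ => δ⁻¹) (fun n => (hmeasK _).aestronglyMeasurable)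
      (integrable_const _) ?_ ?_
    · intro n
      filter_upwards [h2'] with a ha
      rw [Real.norm_eq_abs, abs_of_nonneg]
      · exact ha.2.1 _ (Nat.le_add_left _ _)
      · rw [ha.2.2 (n + K₁)]
        exact div_nonneg (hu0 _ _) (integral_nonneg fun a' => hu0 _ _)
    · filter_upwards [h2'] with a ha using ha.1.comp (tendsto_add_atTop_nat K₁)
  -- (5) the fibre integrals of the conditional densities are exactly `1` for large `K`
  have hone : ∀ᶠ n in atTop, ∫ a, u (n + K₁) (update W e a) / c (n + K₁) (update W e a) ∂η = 1 := by
    have hcpos : ∀ᶠ n in atTop, 0 < c (n + K₁) W := (tendsto_add_atTop_nat K₁).eventually h3.2.2.2.2.1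
    filter_upwards [hcpos] with n hn
    have hinvK : ∀ a, c (n + K₁) (update W e a) = c (n + K₁) W := fun a =>
      apply_update_eq_of_measurable_comap e (hcm _) W a
    simp_rw [hinvK]
    rw [integral_div, ← h3.2.2.2.2.2 (n + K₁)]
    exact div_self hn.ne'
  have hlim1 : Tendsto (fun n => ∫ a, u (n + K₁) (update W e a) / c (n + K₁) (update W e a) ∂η) atTop (𝓝 1) :=
    tendsto_const_nhds.congr' (hone.mono fun n hn => hn.symm)
  exact tendsto_nhds_unique hdc hlim1

omit [DecidableEq ι] in
/-- **CONTINUITY AND UNIFORM FLOOR OF THE LIMIT SPECIFICATION**: for a continuous positive ratio limit `R` on the compact product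
`(ι → G) × G`, `W ↦ (∫ R(W,a) dη(a))⁻¹` is continuous (dominated convergence, constant bound) and bounded below by
`(max (sup R) 1)⁻¹ > 0`. [cite: FriedliVelenik2017, Lemma 6.27] -/
theorem continuous_invIntegral [TopologicalSpace G] [CompactSpace G] [OpensMeasurableSpace G] [FirstCountableTopology G]
    (R : (ι → G) × G → ℝ) (hR : Continuous R) (hR0 : ∀ z, 0 < R z) :
    Continuous (fun W : ι → G => (∫ a, R (W, a) ∂η)⁻¹) ∧
      ∃ δ' : ℝ, 0 < δ' ∧ ∀ W : ι → G, δ' ≤ (∫ a, R (W, a) ∂η)⁻¹ := by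
  obtain ⟨M, hM⟩ : ∃ M : ℝ, ∀ z, R z ≤ M := by
    have hb : BddAbove (range R) := (isCompact_range hR).bddAbove
    exact ⟨sSup (range R), fun z => le_csSup hb (mem_range_self z)⟩
  have hmeasW : ∀ W : ι → G, AEStronglyMeasurable (fun a => R (W, a)) η := fun W =>
    (hR.comp (continuous_const.prodMk continuous_id)).aestronglyMeasurable
  have hint : ∀ W : ι → G, Integrable (fun a => R (W, a)) η := fun W =>
    Integrable.of_bound (hmeasW W) M
      (Eventually.of_forall fun a => by rw [Real.norm_eq_abs, abs_of_pos (hR0 _)]; exact hM _)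
  have hIpos : ∀ W : ι → G, 0 < ∫ a, R (W, a) ∂η := fun W => by
    rw [integral_pos_iff_support_of_nonneg (fun a => (hR0 (W, a)).le) (hint W)]
    have hsupp : support (fun a => R (W, a)) = univ := eq_univ_of_forall fun a => (hR0 (W, a)).ne'
    rw [hsupp, measure_univ]
    exact zero_lt_one
  have hIcont : Continuous fun W : ι → G => ∫ a, R (W, a) ∂η :=
    continuous_of_dominated (F := fun (W : ι → G) (a : G) => R (W, a)) (bound := fun _ => M)
      hmeasW
      (fun W => Eventually.of_forall fun a => by rw [Real.norm_eq_abs, abs_of_pos (hR0 _)]; exact hM _)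
      (integrable_const M) (Eventually.of_forall fun a => hR.comp (continuous_id.prodMk continuous_const))
  have hmax : 0 < max M 1 := lt_of_lt_of_le zero_lt_one (le_max_right _ _)
  refine ⟨hIcont.inv₀ fun W => (hIpos W).ne', (max M 1)⁻¹, inv_pos.mpr hmax, fun W => ?_⟩
  have hIle : ∫ a, R (W, a) ∂η ≤ max M 1 := by
    calc ∫ a, R (W, a) ∂η ≤ ∫ _a, M ∂η := integral_mono (hint W) (integrable_const M) fun a => hM _
      _ = M := by simp
      _ ≤ max M 1 := le_max_left _ _
  exact inv_anti₀ (hIpos W) hIle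

end Product

end Summit.QuantumFields.YangMills.Theorems.SpecificationCompactnessFibreRatioKernel

end
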